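import Summits.QuantumFields.YangMills.Theorems.BalabanUVNodesN12ForestSliceCurved
import Summits.QuantumFields.YangMills.Theorems.BalabanUVNodesN12DirectSurjHsurjProxiesPrelimB
import Summits.QuantumFields.YangMills.Theorems.BalabanUVNodesN12HsurjOfClassLam
import Summits.QuantumFields.YangMills.Theorems.BalabanUVNodesN12RootedForestLamOfRecord
import Summits.QuantumFields.YangMills.Theorems.BalabanUVNodesN12TowerProxiesOfClassB
import HarnessLib

/-!
# BalabanUVNodes ∕ N12 — SURJECTIVITY FROM THE FOREST SLICE AT AN UNGUARDED BASE **OVER A BOND-LEVEL DATUM `𝔅`**, and at PRINT's datum `lamBondsSeq (maxDomT ν.M₁ Z) k` ([II] (2.3)) with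
# the PRINT-ROOTED forest: the (F)-edition of this seat's g11 `…N12ForestSliceOfProxies` (✓p706207) — fewer roots (print tower sites only), print's chart `msChartB`, print minimisers

[Balaban1984PropagatorsII] (2.3) p. 224; [Balaban1985Variational] (4) p. 278, (16)–(18) p. 280, (44)–(48) p. 285, (82)–(83) p. 290; [Balaban1985Averaging] (11) p. 19; [Balaban1985RegularSpaces]
(1.19) p. 79; [Balaban1988Convergent] (2.2) p. 255, (2.10)–(2.13) pp. 256–257; [Balaban1987RG1] (0.4) p. 253.
Cell `pub-ymgap` (D-0062 ∕ D-0149), WIDTH SEAT `pub-ymgap-dag-n12-w6` g25 (N12 = [B15]; key K1⁹ `stmt-QuantumFields-27364`, `--kind proof --supports … --as helper`; count-neutral).  THEOREMS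
ONLY (0 `def`, 0 `instance`, 0 `sorry`); the (F) split of record (dag-n12-d g32 ∕ dag-lead WORDS 426∕429).  §1–§3 = the parent's proofs VERBATIM over `𝔅 : BDetSet` (roots `R(𝔅, k) =
{ι_j c± : j ≤ k, c ∈ 𝔅 j}`), by name over w3's `N12ForestSliceCurved.exists_twisted_residual_of_forest` ∕ `dIterL_orbitTangent_apply_eq_zero` (root-generic ∕ datum-free), the lane's
`Node00/MultiScaleFibreChartB` ∕ `…LagrangeB`, dag-n12-d's `…DirectSurjHsurjProxiesPrelimB` ∕ `…TowerProxiesOfClassB`; §4–§5 over this seat's `…N12HsurjOfClassLam` and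
`…N12RootedForestLamOfRecord`.  Imports green (no `Record13*`).

WHY.  Print's (45) right inverse lives in the slice of a forest rooted at PRINT's tower sites and inverts the derivative of PRINT's chart at a PRINT minimiser; the parent's mechanism is
root-set-generic (`DΨ(0)` kills the twisted residual orbit tangent row by row since `ξ = 0` at both centres of every constrained bond — print roots for print rows); no (b)-row enters.

CONTENTS (namespace `…N12ForestSliceOfProxiesB`; parent names kept, `_Bj ↦ _lamBondsSeq`): §1 `fderiv_msChart_orbitTangent_apply_eq_zero` · §2 `…_of_sharpProxy` · §3 ★★★
`exists_forest_preimage_of_surjective_proxies (𝔅)`, `exists_forest_rightInverse_of_surjective_proxies` · §4 `towerProxies_lamBondsSeq_of_Bj`, ★★★ `exists_forest_rightInverse_lamBondsSeq_of_surjective_proxies`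
· §5 ★★★ `exists_forest_rightInverse_lamBondsSeq_of_isMinimizerB_class` (at the print minimiser feed `hW := hmin.agreeOnB`), ★★★ `…_of_isMinimizerB_class_atRecord` (ONE print-rooted forest).

HONEST FRAMING.  Bookkeeping by name; per-height EXISTENCE letters (print's volume-uniform (46) NOT claimed); existence ∕ uniqueness of the print minimiser is the hypothesis `hmin` (FLAG
№16 untouched); nothing of Bałaban's estimates asserted or refuted; count-neutral helper; N12 NOT discharged; K0⁷∕K1⁹ NOT closed; counts of record unmoved; one finite 𝕋⁴ programme at fixed
ε — R4 closes only the conditional rung `BalabanLadder.UV`; no summit statement is proved here and NOT the Yang–Mills mass gap (Clay); nothing continuum ∕ ℝ⁴ ∕ OS.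
-/

noncomputable section
namespace Summit.QuantumFields.YangMills.BalabanUVNodes.N12ForestSliceOfProxiesB

open scoped BigOperators Matrix.Norms.L2Operator Topology
open Filter
open Literature.MathematicalPhysics.QuantumFieldTheory.Balaban1983to89
open T4Continuum
open B15DeterminingSets B15DeterminingSetsB
open BlockAveraging (blockAvg)
open ExpMeanLog (expMeanLogSU deltaSU)
open T4AdjointCovarianceUnitary (lieSU expSU specialUnitaryAd coe_specialUnitaryAd mem_lieSU_iff)
open Node00
open B16Sect1Backgrounds (toMS iter_gaugeAct)
open B5Eq118OneStroke (iterBlockOf)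
open Summit.QuantumFields.YangMills.BalabanUVNodes.N12ForestSliceCurved (exists_twisted_residual_of_forest dIterL_orbitTangent_apply_eq_zero)
open Summit.QuantumFields.YangMills.BalabanUVNodes.N12DirectSurjHsurjProxiesPrelimB (fderiv_msChart_apply_eq_of_sharpProxy fderiv_msChart_apply_eq_zero_of_vanish_sharp'
  differentiableAt_msChart_of_towerProxies)

/-! ## §1  Orbit tangents are killed by `DΨ_U(0)` at a guarded base — chart currency over a bond datum, `SmallBelow` only -/

section Guarded

variable {F : T4Family} {N : ℕ} [NeZero N] {K k : ℕ}

/-- ★★ **`DΨ_U(0)` KILLS THE RESIDUAL ORBIT TANGENTS — BOND-DATUM CHART, `SmallBelow` ONLY.**  At a base field `U` with the (0.4) guards below `k` and the chart `msChartB … 𝔅 (M˙U) U`: for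
`ξ : T_η → 𝔰𝔲(N)` vanishing at the two centres `ι_j c₋`, `ι_j c₊` of the constrained bond `(j, c)` of `𝔅` enumerated `i`, the `i`-th component of `DΨ_U(0)` at the orbit tangent
`X^ξ_b = Ad(U_b⁻¹)ξ(b₋) − ξ(b₊)` vanishes (dag-n12-w3's `dIterL_orbitTangent_apply_eq_zero` read through `fderiv_msChartB_apply_of_hasDerivAt` and `hasDerivAt_coeField_iter_expChart_smul`).
[cite: Balaban1985Averaging, (11) p.19; Balaban1985Variational, (3)–(4) p.278, Sect. C (44)–(48) p.285, (83) p.290; Balaban1987RG1, (0.21) p.256; Balaban1984PropagatorsII, (2.3) p.224] -/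
theorem fderiv_msChart_orbitTangent_apply_eq_zero (hk : k ≤ (F.P K).m + (F.P K).K) {U : GaugeField (F.P K) 0 (SU N)} (hsb : SmallBelow (avOfRecord F N K) k U)
    (𝔅 : BDetSet (F.P K)) (ξ : Site (F.P K) 0 → lieSU (Fin N)) (i : Fin (constrCardB 𝔅 k))
    (hsrc : ξ (embIter ((constrEnumB 𝔅 k).symm i).1 ((constrEnumB 𝔅 k).symm i).2.1.src) = 0)
    (htgt : ξ (embIter ((constrEnumB 𝔅 k).symm i).1 ((constrEnumB 𝔅 k).symm i).2.1.tgt) = 0) :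
    fderiv ℝ (msChartB F N K k 𝔅 (avgFamily (avOfRecord F N K) U) U) 0 (fun b => specialUnitaryAd (U b)⁻¹ (ξ b.src) - ξ b.tgt) i = 0 := by
  set s := (constrEnumB 𝔅 k).symm i with hs
  have hj : (s.1 : ℕ) ≤ k := Nat.lt_succ_iff.1 s.1.2
  have hjK : (s.1 : ℕ) ≤ (F.P K).m + (F.P K).K := hj.trans hk
  have hsbj : SmallBelow (fun i => blockAvg (P := F.P K) (j := i) (expMeanLogSU (n := Fin N))) (s.1 : ℕ) U := hsb.mono hj
  set T : PBond (F.P K) 0 → lieSU (Fin N) := fun b => specialUnitaryAd (U b)⁻¹ (ξ b.src) - ξ b.tgt with hT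
  -- the velocity of the level-`j` average along the chart ray `t ↦ U·exp(tT)`
  have hvel := hasDerivAt_coeField_iter_expChart_smul hsbj T
  -- the velocity field `b ↦ U_b·T_b` IS the gauge velocity `ξ(b₋)U_b − U_b ξ(b₊)`
  have hTeq : (fun b : PBond (F.P K) 0 => (U b : Matrix (Fin N) (Fin N) ℂ) * ((T b : lieSU (Fin N)) : Matrix (Fin N) (Fin N) ℂ)) =
      fun b => (ξ b.src : Matrix (Fin N) (Fin N) ℂ) * (U b : Matrix (Fin N) (Fin N) ℂ) - (U b : Matrix (Fin N) (Fin N) ℂ) * (ξ b.tgt : Matrix (Fin N) (Fin N) ℂ) := by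
    funext b
    have hinv : (((U b)⁻¹ : SU N) : Matrix (Fin N) (Fin N) ℂ) = star ((U b : SU N) : Matrix (Fin N) (Fin N) ℂ) := rfl
    rw [hT, Submodule.coe_sub, coe_specialUnitaryAd, hinv, star_star, mul_sub, ← mul_assoc, ← mul_assoc, coe_mul_star_coe_SU, one_mul]
  have hzero : dIterL (s.1 : ℕ) (coeField U) (fun b => (U b : Matrix (Fin N) (Fin N) ℂ) * ((T b : lieSU (Fin N)) : Matrix (Fin N) (Fin N) ℂ)) s.2.1 = 0 := by
    rw [hTeq]; exact dIterL_orbitTangent_apply_eq_zero hjK hsbj ξ s.2.1 hsrc htgt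
  have hvelc : HasDerivAt (fun t : ℝ => ((avgFamily (avOfRecord F N K) (expChart U (t • T)) s.1 s.2.1 : SU N) : Matrix (Fin N) (Fin N) ℂ))
      (0 : Matrix (Fin N) (Fin N) ℂ) 0 := by
    have h := (hasDerivAt_pi.1 hvel) s.2.1
    rw [hzero] at h
    exact h
  rw [fderiv_msChartB_apply_of_hasDerivAt (fun _ _ _ => rfl) hsb T i hvelc, mul_zero, map_zero]

end Guarded

/-! ## §2  The same at an UNGUARDED base, from one guarded proxy agreeing with `U₀` on the row's sharp tower -/

section Proxy

variable {F : T4Family} {N : ℕ} [NeZero N] {K k : ℕ}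

/-- `embIter 0 ∘ iterBlockOf 0 = id` (both are the identity at level `0`; stated at a variable level `j = 0` for dependent rewriting) — the parent's two-line lemma, kept private here to keep
the import cone small. [folklore] -/
private theorem embIter_iterBlockOf_of_eq_zero {P : Params} {j : ℕ} (h : j = 0) (x : Site P 0) : embIter j (iterBlockOf j x) = x := by
  subst h; rfl

/-- ★★ **ORBIT TANGENTS ARE KILLED AT AN UNGUARDED BASE `U₀`, GIVEN ONE GUARDED PROXY ON THE ROW's SHARP TOWER** (bond-datum chart): `U₀` in the `𝔅`-fibre of a datum `W` with `Ψ_{𝔅,W,U₀}`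
differentiable at `0`; for the row `i = (j, c)` a proxy `U′` with the (0.4) guards below `k` agreeing with `U₀` on the sharp tower of `c`; `ξ` vanishing at the two centres of `c`.  Then
`(DΨ_{𝔅,W,U₀}(0) X^ξ_{U₀})_i = 0` (component transfer to the proxy's own chart, the tangents agree on the sharp tower, §1 at `U′`).  NO guard on `U₀`.
[cite: Balaban1985Averaging, (11) p.19; Balaban1985Variational, (3)–(4) p.278, Sect. C (44)–(48) p.285, (82)–(83) p.290; Balaban1988Convergent, (2.10)–(2.11) p.256; Balaban1987RG1, (0.4) p.253] -/
theorem fderiv_msChart_orbitTangent_apply_eq_zero_of_sharpProxy (hk : k ≤ (F.P K).m + (F.P K).K) {𝔅 : BDetSet (F.P K)} {W : MSField (F.P K) (SU N)}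
    {U₀ U' : GaugeField (F.P K) 0 (SU N)} (hU : AgreeOnB 𝔅 (avgFamily (avOfRecord F N K) U₀) W) (hΨ : DifferentiableAt ℝ (msChartB F N K k 𝔅 W U₀) 0)
    (hsb' : SmallBelow (avOfRecord F N K) k U') (i : Fin (constrCardB 𝔅 k))
    (hin : ∀ b₀ : PBond (F.P K) 0,
      (iterBlockOf (((constrEnumB 𝔅 k).symm i).1 : ℕ) b₀.src = ((constrEnumB 𝔅 k).symm i).2.1.src ∨
        iterBlockOf (((constrEnumB 𝔅 k).symm i).1 : ℕ) b₀.src = ((constrEnumB 𝔅 k).symm i).2.1.tgt) →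
      (iterBlockOf (((constrEnumB 𝔅 k).symm i).1 : ℕ) b₀.tgt = ((constrEnumB 𝔅 k).symm i).2.1.src ∨
        iterBlockOf (((constrEnumB 𝔅 k).symm i).1 : ℕ) b₀.tgt = ((constrEnumB 𝔅 k).symm i).2.1.tgt) → U' b₀ = U₀ b₀)
    (ξ : Site (F.P K) 0 → lieSU (Fin N))
    (hsrc : ξ (embIter ((constrEnumB 𝔅 k).symm i).1 ((constrEnumB 𝔅 k).symm i).2.1.src) = 0)
    (htgt : ξ (embIter ((constrEnumB 𝔅 k).symm i).1 ((constrEnumB 𝔅 k).symm i).2.1.tgt) = 0) :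
    fderiv ℝ (msChartB F N K k 𝔅 W U₀) 0 (fun b => specialUnitaryAd (U₀ b)⁻¹ (ξ b.src) - ξ b.tgt) i = 0 := by
  set T₀ : PBond (F.P K) 0 → lieSU (Fin N) := fun b => specialUnitaryAd (U₀ b)⁻¹ (ξ b.src) - ξ b.tgt with hT₀
  set T' : PBond (F.P K) 0 → lieSU (Fin N) := fun b => specialUnitaryAd (U' b)⁻¹ (ξ b.src) - ξ b.tgt with hT'
  -- the component at the proxy's own chart
  rw [fderiv_msChart_apply_eq_of_sharpProxy hk hU hΨ hsb' i hin T₀]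
  have hΨ' : DifferentiableAt ℝ (msChartB F N K k 𝔅 (avgFamily (avOfRecord F N K) U') U') 0 :=
    differentiableAt_msChartB (K := K) (k := k) (𝔅 := 𝔅) (W := avgFamily (avOfRecord F N K) U') (U := U') (fun _ _ _ => rfl) hsb'
  -- `T₀ − T'` vanishes on the sharp tower of the row
  have hvan : fderiv ℝ (msChartB F N K k 𝔅 (avgFamily (avOfRecord F N K) U') U') 0 (T₀ - T') i = 0 :=
    fderiv_msChart_apply_eq_zero_of_vanish_sharp' hk hΨ' (T₀ - T') i fun b₀ hs ht => by
      simp only [Pi.sub_apply, hT₀, hT', hin b₀ hs ht, sub_self]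
  have heq : fderiv ℝ (msChartB F N K k 𝔅 (avgFamily (avOfRecord F N K) U') U') 0 T₀ i =
      fderiv ℝ (msChartB F N K k 𝔅 (avgFamily (avOfRecord F N K) U') U') 0 T' i := by
    rw [map_sub, Pi.sub_apply, sub_eq_zero] at hvan
    exact hvan
  rw [heq]
  exact fderiv_msChart_orbitTangent_apply_eq_zero hk hsb' 𝔅 ξ i hsrc htgt

end Proxy

/-! ## §3  Surjectivity FROM THE FOREST SLICE at an unguarded base, from per-row sharp proxies — bond datum, roots `R(𝔅, k)` -/

section Curved

variable {F : T4Family} {N : ℕ} [NeZero N] {K k : ℕ}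

/-- ★★★ **SURJECTIVITY FROM THE FOREST SLICE AT AN UNGUARDED BASE — BOND DATUM**: differentiability of `Ψ_{𝔅,W,U₀}` at `0`; for every row of POSITIVE level one guarded proxy agreeing with `U₀`
on the row's sharp tower (level-`0` rows need nothing: both end-points are roots); general datum `W` with `U₀` in its `𝔅`-fibre.  If `DΨ_{𝔅,W,U₀}(0)` is onto on the whole space, every
target is attained by a field VANISHING ON EVERY PATH BOND of any rooted forest with (F1) whose roots contain `R(𝔅, k) = {ι_j c± : j ≤ k, c ∈ 𝔅 j}` — for print's datum: print's tower sites.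
[cite: Balaban1985Variational, (4) p.278, (16)–(18) p.280, (45)–(48) p.285, (82)–(83) p.290; Balaban1985Averaging, (11) p.19; Balaban1985RegularSpaces, (1.19) p.79; Balaban1988Convergent, (2.10)–(2.11) p.256; Balaban1984PropagatorsII, (2.3) p.224] -/
theorem exists_forest_preimage_of_surjective_proxies (𝔅 : BDetSet (F.P K)) (hk : k ≤ (F.P K).m + (F.P K).K)
    {W : MSField (F.P K) (SU N)} {U₀ : GaugeField (F.P K) 0 (SU N)} (hU : AgreeOnB 𝔅 (avgFamily (avOfRecord F N K) U₀) W)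
    (hΨ : DifferentiableAt ℝ (msChartB F N K k 𝔅 W U₀) 0)
    (hsharp : ∀ i : Fin (constrCardB 𝔅 k), 1 ≤ (((constrEnumB 𝔅 k).symm i).1 : ℕ) → ∃ U' : GaugeField (F.P K) 0 (SU N),
      SmallBelow (avOfRecord F N K) k U' ∧ ∀ b₀ : PBond (F.P K) 0,
        (iterBlockOf (((constrEnumB 𝔅 k).symm i).1 : ℕ) b₀.src = ((constrEnumB 𝔅 k).symm i).2.1.src ∨
          iterBlockOf (((constrEnumB 𝔅 k).symm i).1 : ℕ) b₀.src = ((constrEnumB 𝔅 k).symm i).2.1.tgt) →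
        (iterBlockOf (((constrEnumB 𝔅 k).symm i).1 : ℕ) b₀.tgt = ((constrEnumB 𝔅 k).symm i).2.1.src ∨
          iterBlockOf (((constrEnumB 𝔅 k).symm i).1 : ℕ) b₀.tgt = ((constrEnumB 𝔅 k).symm i).2.1.tgt) → U' b₀ = U₀ b₀)
    {path : Site (F.P K) 0 → List (LStep (F.P K) 0)}
    (hroot : ∀ r ∈ {z : Site (F.P K) 0 | ∃ j, j ≤ k ∧ ∃ c ∈ 𝔅 j, (z = embIter j c.src ∨ z = embIter j c.tgt)}, path r = [])
    (hF1 : ∀ x, ∀ s ∈ path x, ∃ x' x'' : Site (F.P K) 0, path x'' = path x' ++ [s] ∧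
      (s.fwd = true → s.bond.src = x' ∧ s.bond.tgt = x'') ∧ (s.fwd = false → s.bond.src = x'' ∧ s.bond.tgt = x'))
    (hsurj : Function.Surjective (fderiv ℝ (msChartB F N K k 𝔅 W U₀) 0))
    (τ : Fin (constrCardB 𝔅 k) → lieSU (Fin N)) :
    ∃ X : PBond (F.P K) 0 → lieSU (Fin N), (∀ x, ∀ s ∈ path x, X s.bond = 0) ∧ fderiv ℝ (msChartB F N K k 𝔅 W U₀) 0 X = τ := by
  obtain ⟨X₀, hX₀⟩ := hsurj τ
  obtain ⟨ξ, hξR, hξ⟩ := exists_twisted_residual_of_forest hroot hF1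
    (fun b => (specialUnitaryAd (U₀ b)⁻¹).toLinearEquiv.toAddEquiv) (fun _ => AddEquiv.refl _) X₀
  have hT : fderiv ℝ (msChartB F N K k 𝔅 W U₀) 0 (fun b => specialUnitaryAd (U₀ b)⁻¹ (ξ b.src) - ξ b.tgt) = 0 := by
    funext i
    rw [Pi.zero_apply]
    have hj : (((constrEnumB 𝔅 k).symm i).1 : ℕ) ≤ k := Nat.le_of_lt_succ ((constrEnumB 𝔅 k).symm i).1.isLt
    have hc : ((constrEnumB 𝔅 k).symm i).2.1 ∈ 𝔅 ((constrEnumB 𝔅 k).symm i).1 := ((constrEnumB 𝔅 k).symm i).2.2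
    have hsrc : ξ (embIter ((constrEnumB 𝔅 k).symm i).1 ((constrEnumB 𝔅 k).symm i).2.1.src) = 0 := hξR _ ⟨_, hj, _, hc, Or.inl rfl⟩
    have htgt : ξ (embIter ((constrEnumB 𝔅 k).symm i).1 ((constrEnumB 𝔅 k).symm i).2.1.tgt) = 0 := hξR _ ⟨_, hj, _, hc, Or.inr rfl⟩
    rcases Nat.eq_zero_or_pos (((constrEnumB 𝔅 k).symm i).1 : ℕ) with h0 | hpos
    · -- level `0`: the tangent vanishes on the sharp tower of the row (both end-points are roots)
      refine fderiv_msChart_apply_eq_zero_of_vanish_sharp' hk hΨ _ i fun b₀ hs ht => ?_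
      have hs' : ξ b₀.src = 0 := by
        rw [← embIter_iterBlockOf_of_eq_zero h0 b₀.src]
        rcases hs with h | h
        · rw [h]; exact hsrc
        · rw [h]; exact htgt
      have ht' : ξ b₀.tgt = 0 := by
        rw [← embIter_iterBlockOf_of_eq_zero h0 b₀.tgt]
        rcases ht with h | h
        · rw [h]; exact hsrc
        · rw [h]; exact htgt
      simp only [hs', ht', map_zero, sub_zero]
    · obtain ⟨U', hsb', hin⟩ := hsharp i hpos
      exact fderiv_msChart_orbitTangent_apply_eq_zero_of_sharpProxy hk hU hΨ hsb' i hin ξ hsrc htgt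
  refine ⟨fun b => X₀ b - (specialUnitaryAd (U₀ b)⁻¹ (ξ b.src) - ξ b.tgt), fun x s hs => ?_, ?_⟩
  · have h := hξ x s hs
    show X₀ s.bond - _ = 0
    rw [sub_eq_zero]
    exact h
  · have hsub : (fun b => X₀ b - (specialUnitaryAd (U₀ b)⁻¹ (ξ b.src) - ξ b.tgt)) =
        X₀ - fun b => specialUnitaryAd (U₀ b)⁻¹ (ξ b.src) - ξ b.tgt := rfl
    rw [hsub, map_sub, hX₀, hT, sub_zero]

/-- ★★ **A LINEAR RIGHT INVERSE OF `DΨ_{𝔅,W,U₀}(0)` VALUED IN THE FOREST SLICE AT AN UNGUARDED BASE** ([15] (45) for the tree gauge, chart currency, bond datum): from §3's preimages.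
[cite: Balaban1985Variational, (45) p.285, (4) p.278, (16)–(18) p.280; Balaban1985Averaging, (11) p.19; Balaban1985RegularSpaces, (1.19) p.79; Balaban1988Convergent, (2.10)–(2.11) p.256; Balaban1984PropagatorsII, (2.3) p.224] -/
theorem exists_forest_rightInverse_of_surjective_proxies (𝔅 : BDetSet (F.P K)) (hk : k ≤ (F.P K).m + (F.P K).K)
    {W : MSField (F.P K) (SU N)} {U₀ : GaugeField (F.P K) 0 (SU N)} (hU : AgreeOnB 𝔅 (avgFamily (avOfRecord F N K) U₀) W)
    (hΨ : DifferentiableAt ℝ (msChartB F N K k 𝔅 W U₀) 0)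
    (hsharp : ∀ i : Fin (constrCardB 𝔅 k), 1 ≤ (((constrEnumB 𝔅 k).symm i).1 : ℕ) → ∃ U' : GaugeField (F.P K) 0 (SU N),
      SmallBelow (avOfRecord F N K) k U' ∧ ∀ b₀ : PBond (F.P K) 0,
        (iterBlockOf (((constrEnumB 𝔅 k).symm i).1 : ℕ) b₀.src = ((constrEnumB 𝔅 k).symm i).2.1.src ∨
          iterBlockOf (((constrEnumB 𝔅 k).symm i).1 : ℕ) b₀.src = ((constrEnumB 𝔅 k).symm i).2.1.tgt) →
        (iterBlockOf (((constrEnumB 𝔅 k).symm i).1 : ℕ) b₀.tgt = ((constrEnumB 𝔅 k).symm i).2.1.src ∨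
          iterBlockOf (((constrEnumB 𝔅 k).symm i).1 : ℕ) b₀.tgt = ((constrEnumB 𝔅 k).symm i).2.1.tgt) → U' b₀ = U₀ b₀)
    {path : Site (F.P K) 0 → List (LStep (F.P K) 0)}
    (hroot : ∀ r ∈ {z : Site (F.P K) 0 | ∃ j, j ≤ k ∧ ∃ c ∈ 𝔅 j, (z = embIter j c.src ∨ z = embIter j c.tgt)}, path r = [])
    (hF1 : ∀ x, ∀ s ∈ path x, ∃ x' x'' : Site (F.P K) 0, path x'' = path x' ++ [s] ∧
      (s.fwd = true → s.bond.src = x' ∧ s.bond.tgt = x'') ∧ (s.fwd = false → s.bond.src = x'' ∧ s.bond.tgt = x'))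
    (hsurj : Function.Surjective (fderiv ℝ (msChartB F N K k 𝔅 W U₀) 0)) :
    ∃ H : (Fin (constrCardB 𝔅 k) → lieSU (Fin N)) →ₗ[ℝ] (PBond (F.P K) 0 → lieSU (Fin N)),
      (∀ τ, ∀ x, ∀ s ∈ path x, H τ s.bond = 0) ∧ ∀ τ, fderiv ℝ (msChartB F N K k 𝔅 W U₀) 0 (H τ) = τ := by
  let S : Submodule ℝ (PBond (F.P K) 0 → lieSU (Fin N)) :=
    { carrier := {X | ∀ x, ∀ s ∈ path x, X s.bond = 0}
      add_mem' := fun {X Y} hX hY x s hs => by simp only [Pi.add_apply, hX x s hs, hY x s hs, add_zero]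
      zero_mem' := fun _ _ _ => rfl
      smul_mem' := fun c X hX x s hs => by simp only [Pi.smul_apply, hX x s hs, smul_zero] }
  set D := fderiv ℝ (msChartB F N K k 𝔅 W U₀) 0 with hD
  have hrange : LinearMap.range ((D : (PBond (F.P K) 0 → lieSU (Fin N)) →ₗ[ℝ] (Fin (constrCardB 𝔅 k) → lieSU (Fin N))) ∘ₗ S.subtype) = ⊤ := by
    refine LinearMap.range_eq_top.2 fun τ => ?_
    obtain ⟨X, hXS, hX⟩ := exists_forest_preimage_of_surjective_proxies 𝔅 hk hU hΨ hsharp hroot hF1 hsurj τ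
    exact ⟨⟨X, hXS⟩, hX⟩
  obtain ⟨g, hg⟩ := LinearMap.exists_rightInverse_of_surjective _ hrange
  refine ⟨S.subtype ∘ₗ g, fun τ => (g τ).2, fun τ => ?_⟩
  have h := LinearMap.congr_fun hg τ
  simpa only [LinearMap.comp_apply, LinearMap.id_apply, ContinuousLinearMap.coe_coe] using h

end Curved

/-! ## §4  At print's datum `lamBondsSeq (maxDomT M₁ Z) k`: the sharp proxies per row from ONE proxy per inner site (p678596's `hproxSite` shape), differentiability from ONE proxy per print row -/

section Record

open Literature.MathematicalPhysics.QuantumFieldTheory.Balaban1983to89.B14.Eq213DetSet (Bj maxDomT)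
open Literature.MathematicalPhysics.QuantumFieldTheory.Balaban1983to89.B14.Eq213MaximalDomains (side)
open Literature.MathematicalPhysics.QuantumFieldTheory.Balaban1983to89.B14.Eq216Concrete (feeds)
open Summit.QuantumFields.YangMills.BalabanUVNodes.N12DirectSurjHsurjPrelim (inner_endpoint_of_mem_bondsOf_Bj)

variable {F : T4Family} {N : ℕ} [NeZero N] {K k : ℕ}

/-- **(b)-ROW PROXIES ⟹ PRINT-ROW PROXIES** (print's rows are (b)-rows of the same bond, F0a): p678596's `hprox` text over `constrEnum (Bj M₁ Z k) k` yields the print-row shape of §4 —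
for consumers displaying the (b)-shaped letter. [cite: Balaban1984PropagatorsII, (2.3) p.224; Balaban1988Convergent, (2.2) p.255 (bookkeeping)] -/
theorem towerProxies_lamBondsSeq_of_Bj {M₁ : ℕ} {Z : Set (Site (F.P K) 0)} {U₀ : GaugeField (F.P K) 0 (SU N)}
    (hprox : ∀ i : Fin (constrCard (Bj M₁ Z k) k), ∃ U' : GaugeField (F.P K) 0 (SU N),
      (∀ b ∈ feeds (((constrEnum (Bj M₁ Z k) k).symm i).1 : ℕ) ((constrEnum (Bj M₁ Z k) k).symm i).2.1, U' b = U₀ b) ∧ SmallBelow (avOfRecord F N K) k U') :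
    ∀ i : Fin (constrCardB (lamBondsSeq (maxDomT M₁ Z) k) k), ∃ U' : GaugeField (F.P K) 0 (SU N),
      (∀ b ∈ feeds (((constrEnumB (lamBondsSeq (maxDomT M₁ Z) k) k).symm i).1 : ℕ) ((constrEnumB (lamBondsSeq (maxDomT M₁ Z) k) k).symm i).2.1, U' b = U₀ b) ∧
        SmallBelow (avOfRecord F N K) k U' := by
  intro i
  set x : ConstrSet (Bj M₁ Z k : DetSet (F.P K)) k := ⟨((constrEnumB (lamBondsSeq (maxDomT M₁ Z) k) k).symm i).1,
    ⟨((constrEnumB (lamBondsSeq (maxDomT M₁ Z) k) k).symm i).2.1, lamBondsSeq_subset_bondsOf_genSet _ _ _ ((constrEnumB (lamBondsSeq (maxDomT M₁ Z) k) k).symm i).2.2⟩⟩ with hx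
  obtain ⟨U', hin, hsb'⟩ := hprox (constrEnum (Bj M₁ Z k : DetSet (F.P K)) k x)
  have e1 : (constrEnum (Bj M₁ Z k : DetSet (F.P K)) k).symm (constrEnum (Bj M₁ Z k : DetSet (F.P K)) k x) = x := Equiv.symm_apply_apply _ _
  refine ⟨U', fun b hb => hin b ?_, hsb'⟩
  rw [e1]
  exact hb

/-- ★★★ **A LINEAR RIGHT INVERSE OF `D(msChartB … (lamBondsSeq (maxDomT M₁ Z) k) W U₀)(0)` VALUED IN THE PRINT-FOREST SLICE, AT AN UNGUARDED BASE, FROM PROXY LETTERS** — the parent's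
`exists_forest_rightInverse_Bj_of_surjective_proxies` at print's datum: `hprox` = one guarded proxy per PRINT row on `feeds c` (differentiability of print's chart), `hproxSite` = p678596's
per-inner-site letter VERBATIM (every positive-level print row is a (b)-row, hence has an inner end-point); base-point row `AgreeOnB (lamBondsSeq …) (M˙U₀) W`; any rooted forest with (F1),
roots ⊇ print's tower sites; surjectivity DISPLAYED (from the class in §5). [cite: Balaban1984PropagatorsII, (2.3) p.224; Balaban1985Variational, (45) p.285, (4) p.278, (16)–(18) p.280, (82)–(83) p.290; Balaban1985Averaging, (11) p.19; Balaban1988Convergent, (2.2) p.255, (2.10)–(2.13) pp.256–257] -/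
theorem exists_forest_rightInverse_lamBondsSeq_of_surjective_proxies {M₁ : ℕ} {Z : Set (Site (F.P K) 0)} (hk : k ≤ (F.P K).m + (F.P K).K)
    {W : MSField (F.P K) (SU N)} {U₀ : GaugeField (F.P K) 0 (SU N)} (hU : AgreeOnB (lamBondsSeq (maxDomT M₁ Z) k) (avgFamily (avOfRecord F N K) U₀) W)
    (hprox : ∀ i : Fin (constrCardB (lamBondsSeq (maxDomT M₁ Z) k) k), ∃ U' : GaugeField (F.P K) 0 (SU N),
      (∀ b ∈ feeds (((constrEnumB (lamBondsSeq (maxDomT M₁ Z) k) k).symm i).1 : ℕ) ((constrEnumB (lamBondsSeq (maxDomT M₁ Z) k) k).symm i).2.1, U' b = U₀ b) ∧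
        SmallBelow (avOfRecord F N K) k U')
    (hproxSite : ∀ (j : ℕ), 1 ≤ j → j ≤ k → ∀ y : Site (F.P K) j, embIter j y ∈ maxDomT M₁ Z j → ∃ U' : GaugeField (F.P K) 0 (SU N),
      (∀ c : PBond (F.P K) j, (c.src = y ∨ c.tgt = y) → ∀ b₀ : PBond (F.P K) 0,
        (iterBlockOf j b₀.src = c.src ∨ iterBlockOf j b₀.src = c.tgt) → (iterBlockOf j b₀.tgt = c.src ∨ iterBlockOf j b₀.tgt = c.tgt) → U' b₀ = U₀ b₀) ∧
      SmallBelow (avOfRecord F N K) k U')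
    {path : Site (F.P K) 0 → List (LStep (F.P K) 0)}
    (hroot : ∀ r ∈ {z : Site (F.P K) 0 | ∃ j, j ≤ k ∧ ∃ c ∈ lamBondsSeq (maxDomT M₁ Z) k j, (z = embIter j c.src ∨ z = embIter j c.tgt)}, path r = [])
    (hF1 : ∀ x, ∀ s ∈ path x, ∃ x' x'' : Site (F.P K) 0, path x'' = path x' ++ [s] ∧
      (s.fwd = true → s.bond.src = x' ∧ s.bond.tgt = x'') ∧ (s.fwd = false → s.bond.src = x'' ∧ s.bond.tgt = x'))
    (hsurj : Function.Surjective (fderiv ℝ (msChartB F N K k (lamBondsSeq (maxDomT M₁ Z) k) W U₀) 0)) :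
    ∃ H : (Fin (constrCardB (lamBondsSeq (maxDomT M₁ Z) k) k) → lieSU (Fin N)) →ₗ[ℝ] (PBond (F.P K) 0 → lieSU (Fin N)),
      (∀ τ, ∀ x, ∀ s ∈ path x, H τ s.bond = 0) ∧ ∀ τ, fderiv ℝ (msChartB F N K k (lamBondsSeq (maxDomT M₁ Z) k) W U₀) 0 (H τ) = τ := by
  have hΨ : DifferentiableAt ℝ (msChartB F N K k (lamBondsSeq (maxDomT M₁ Z) k) W U₀) 0 := differentiableAt_msChart_of_towerProxies hk hU hprox
  refine exists_forest_rightInverse_of_surjective_proxies (lamBondsSeq (maxDomT M₁ Z) k) hk hU hΨ (fun i hpos => ?_) hroot hF1 hsurj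
  have hjk : (((constrEnumB (lamBondsSeq (maxDomT M₁ Z) k) k).symm i).1 : ℕ) ≤ k := Nat.le_of_lt_succ ((constrEnumB (lamBondsSeq (maxDomT M₁ Z) k) k).symm i).1.isLt
  have hc : ((constrEnumB (lamBondsSeq (maxDomT M₁ Z) k) k).symm i).2.1 ∈ bondsOf ((Bj M₁ Z k : DetSet (F.P K)) ((constrEnumB (lamBondsSeq (maxDomT M₁ Z) k) k).symm i).1) :=
    lamBondsSeq_subset_bondsOf_genSet _ _ _ ((constrEnumB (lamBondsSeq (maxDomT M₁ Z) k) k).symm i).2.2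
  rcases inner_endpoint_of_mem_bondsOf_Bj hpos hjk hc with hy | hy
  · obtain ⟨U', hag, hsb'⟩ := hproxSite _ hpos hjk _ hy
    exact ⟨U', hsb', hag _ (Or.inl rfl)⟩
  · obtain ⟨U', hag, hsb'⟩ := hproxSite _ hpos hjk _ hy
    exact ⟨U', hsb', hag _ (Or.inr rfl)⟩

end Record

/-! ## §5  FROM THE CLASS: the chart-currency (45) letter at print's datum for EVERY class minimiser over any bond datum — no guard on `U₀` -/

section OfClass

open Literature.MathematicalPhysics.QuantumFieldTheory.Balaban1983to89.B14.Eq213DetSet (Bj maxDomT)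
open Literature.MathematicalPhysics.QuantumFieldTheory.Balaban1983to89.B14.Eq213MaximalDomains (side)
open Literature.MathematicalPhysics.QuantumFieldTheory.Balaban1983to89.B14.Eq216Concrete (feeds)
open B15Eq112TorusCover (lift)
open T4AxialGaugeSmallField (boxPlaqs)
open T4CubeChartGnomonic (SU2)
open Summit.QuantumFields.YangMills.BalabanUVNodes.N12TowerProxiesOfClassB (towerProxies_lamBondsSeq_of_mem_class)
open Summit.QuantumFields.YangMills.BalabanUVNodes.N12SiteProxiesOfClass (siteProxies_Bj_of_mem_class)
open Summit.QuantumFields.YangMills.BalabanUVNodes.N12HsurjOfClassLam (surjective_fderiv_msChartB_lamBondsSeq_of_isMinimizerB_class_of_agreeOnB)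
open Summit.QuantumFields.YangMills.BalabanUVNodes.N12RootedForestLamOfRecord (exists_rootedForest_lamBondsSeq_maxDomT)
open T4ReflectionCone (three_le_L)

variable {F : T4Family} {k : ℕ}

/-- ★★★ **THE PRINT-FOREST-SLICE RIGHT INVERSE OF `D(msChartB … (lamBondsSeq (maxDomT ν.M₁ Z) k) W U₀)(0)` FOR EVERY CLASS MINIMISER OVER ANY BOND DATUM — NO GUARD ON `U₀`** ([15] (45) for
print's comb gauge at print's datum): `U₀` with `IsMinimizerB … 𝔅' W' U₀` over the class of record (only membership is read), `W` with `AgreeOnB (lamBondsSeq (maxDomT ν.M₁ Z) k) (M˙U₀) W`, any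
rooted forest with (F1), roots ⊇ print's tower sites; §4 fed by the class (dag-n12-d's `towerProxies_lamBondsSeq_of_mem_class`, §3b `siteProxies_Bj_of_mem_class`, this seat's `…HsurjOfClassLam`);
per-HEIGHT letters `hsbU`, `hHB` (the (b)-socket's ∀-body, unchanged), floors, numerics as in p705019.
[cite: Balaban1984PropagatorsII, (2.3) p.224; Balaban1985Variational, (4) p.278, (16)–(18) p.280, Sect. C (44)–(48) p.285, (82)–(83) p.290; Balaban1985Averaging, (11) p.19; Balaban1985RegularSpaces, (1.19) p.79; Balaban1988Convergent, (2.2) p.255, (2.10)–(2.13) pp.256–257; Balaban1987RG1, (0.4) p.253] -/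
theorem exists_forest_rightInverse_lamBondsSeq_of_isMinimizerB_class (ν : Node00.Stage7Numerics) (Kt : ℕ) (Z : Set (Site (F.P Kt) 0))
    (hkK : k + 1 ≤ (F.P Kt).m + (F.P Kt).K) (hM4 : 4 * (F.P Kt).L ≤ ν.M₁) (hdiv : side (F.P Kt).L ν.M₁ k ∣ (F.P Kt).sitesPerDir 0) (hε : 0 ≤ ν.εreg)
    {ρ'' : ℝ} (hsbU : ∀ V : GaugeField (F.P Kt) 0 SU2, ‖coeField V - 1‖ ≤ ρ'' → SmallBelow (avOfRecord F 2 Kt) k V)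
    (hερ : 6 * ((((F.P Kt).d - 1 : ℕ)) : ℝ) * (F.P Kt).L * ν.εreg ≤ ρ'')
    {εH B : ℝ}
    (hHB : ∀ (Wd : MSField (F.P Kt) SU2) (U₀ : GaugeField (F.P Kt) 0 SU2),
      AgreeOn (Bj ν.M₁ Z k) (avgFamily (avOfRecord F 2 Kt) U₀) Wd →
      (∀ i' : Fin (constrCard (Bj ν.M₁ Z k) k), ∃ U' : GaugeField (F.P Kt) 0 SU2,
        (∀ b ∈ feeds (((constrEnum (Bj ν.M₁ Z k) k).symm i').1 : ℕ) ((constrEnum (Bj ν.M₁ Z k) k).symm i').2.1, U' b = U₀ b) ∧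
          SmallBelow (avOfRecord F 2 Kt) k U') →
      (∀ (j : ℕ), 1 ≤ j → j ≤ k → ∀ y : Site (F.P Kt) j, embIter j y ∈ maxDomT ν.M₁ Z j → ∃ U' : GaugeField (F.P Kt) 0 SU2,
        (∀ c : PBond (F.P Kt) j, (c.src = y ∨ c.tgt = y) → ∀ b₀ : PBond (F.P Kt) 0,
          (iterBlockOf j b₀.src = c.src ∨ iterBlockOf j b₀.src = c.tgt) → (iterBlockOf j b₀.tgt = c.src ∨ iterBlockOf j b₀.tgt = c.tgt) → U' b₀ = U₀ b₀) ∧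
        SmallBelow (avOfRecord F 2 Kt) k U') →
      (∀ (j : ℕ), 1 ≤ j → j ≤ k → ∀ y : Site (F.P Kt) j, embIter j y ∈ maxDomT ν.M₁ Z j →
        PlaqSmallOn (boxPlaqs (fun κ => lift (F.P Kt) (embIter j y) κ - ((((F.P Kt).L ^ j : ℕ) : ℤ) + ((((F.P Kt).L ^ j - 1) / 2 : ℕ) : ℤ)))
          (fun κ => lift (F.P Kt) (embIter j y) κ + ((((F.P Kt).L ^ j : ℕ) : ℤ) + ((((F.P Kt).L ^ j - 1) / 2 : ℕ) : ℤ))) : Set (Plaq (F.P Kt) 0)) εH U₀) →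
      ∃ H : (Fin (constrCard (Bj ν.M₁ Z k) k) → lieSU (Fin 2)) → PBond (F.P Kt) 0 → lieSU (Fin 2),
        (∀ v, fderiv ℝ (msChart F 2 Kt k (Bj ν.M₁ Z k) Wd U₀) 0 (H v) = v) ∧ ∀ v, Real.sqrt (∑ b, ‖H v b‖ ^ 2) ≤ B * ‖v‖)
    (hεH : ν.εreg ≤ εH)
    {𝔅' : BDetSet (F.P Kt)} {W' : MSField (F.P Kt) SU2} {U₀ : GaugeField (F.P Kt) 0 SU2}
    (hmin : IsMinimizerB (avOfRecord F 2 Kt) (regMSCoPOfRecord F 2 ν Kt k (maxDomT ν.M₁ Z)) 𝔅' W' U₀)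
    {W : MSField (F.P Kt) SU2} (hW : AgreeOnB (lamBondsSeq (maxDomT ν.M₁ Z) k) (avgFamily (avOfRecord F 2 Kt) U₀) W)
    {path : Site (F.P Kt) 0 → List (LStep (F.P Kt) 0)}
    (hroot : ∀ r ∈ {z : Site (F.P Kt) 0 | ∃ j, j ≤ k ∧ ∃ c ∈ lamBondsSeq (maxDomT ν.M₁ Z) k j, (z = embIter j c.src ∨ z = embIter j c.tgt)}, path r = [])
    (hF1 : ∀ x, ∀ s ∈ path x, ∃ x' x'' : Site (F.P Kt) 0, path x'' = path x' ++ [s] ∧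
      (s.fwd = true → s.bond.src = x' ∧ s.bond.tgt = x'') ∧ (s.fwd = false → s.bond.src = x'' ∧ s.bond.tgt = x')) :
    ∃ H : (Fin (constrCardB (lamBondsSeq (maxDomT ν.M₁ Z) k) k) → lieSU (Fin 2)) →ₗ[ℝ] (PBond (F.P Kt) 0 → lieSU (Fin 2)),
      (∀ τ, ∀ x, ∀ s ∈ path x, H τ s.bond = 0) ∧ ∀ τ, fderiv ℝ (msChartB F 2 Kt k (lamBondsSeq (maxDomT ν.M₁ Z) k) W U₀) 0 (H τ) = τ :=
  exists_forest_rightInverse_lamBondsSeq_of_surjective_proxies (Nat.le_of_succ_le hkK) hW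
    (towerProxies_lamBondsSeq_of_mem_class ν Kt Z hkK hM4 hdiv hε hsbU hερ hmin.mem_reg)
    (siteProxies_Bj_of_mem_class ν Kt Z hkK hM4 hdiv hε hsbU hερ hmin.mem_reg) hroot hF1
    (surjective_fderiv_msChartB_lamBondsSeq_of_isMinimizerB_class_of_agreeOnB ν Kt Z hkK hM4 hdiv hε hsbU hερ hHB hεH hmin hW)

/-- ★★★ **AT THE RECORD WITH THE PRINT-ROOTED FOREST** (this seat's `…RootedForestLamOfRecord.exists_rootedForest_lamBondsSeq_maxDomT`: (F1), (F2) at print's tower sites, (TREE); `1 ≤ k`):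
ONE forest `path` for `lamBondsSeq (maxDomT ν.M₁ Z) k` such that at EVERY class minimiser `U₀` over any bond datum (only membership is read) and every datum `W` with
`AgreeOnB (lamBondsSeq …) (M˙U₀) W`, `D(msChartB … (lamBondsSeq …) W U₀)(0)` has a LINEAR right inverse valued in the forest slice — the parent's `…_Bj_of_isMinimizer_class_atRecord` at
print's datum and print's roots. [cite: Balaban1984PropagatorsII, (2.3) p.224; Balaban1985Variational, (45) p.285, (4) p.278, (16)–(18) p.280, (82)–(83) p.290; Balaban1985Averaging, (11) p.19; Balaban1988Convergent, (2.2) p.255, (2.10)–(2.13) pp.256–257] -/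
theorem exists_forest_rightInverse_lamBondsSeq_of_isMinimizerB_class_atRecord (ν : Node00.Stage7Numerics) (Kt : ℕ) (Z : Set (Site (F.P Kt) 0))
    (hkK : k + 1 ≤ (F.P Kt).m + (F.P Kt).K) (hk1 : 1 ≤ k) (hM4 : 4 * (F.P Kt).L ≤ ν.M₁) (hdiv : side (F.P Kt).L ν.M₁ k ∣ (F.P Kt).sitesPerDir 0)
    (hε : 0 ≤ ν.εreg)
    {ρ'' : ℝ} (hsbU : ∀ V : GaugeField (F.P Kt) 0 SU2, ‖coeField V - 1‖ ≤ ρ'' → SmallBelow (avOfRecord F 2 Kt) k V)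
    (hερ : 6 * ((((F.P Kt).d - 1 : ℕ)) : ℝ) * (F.P Kt).L * ν.εreg ≤ ρ'')
    {εH B : ℝ}
    (hHB : ∀ (Wd : MSField (F.P Kt) SU2) (U₀ : GaugeField (F.P Kt) 0 SU2),
      AgreeOn (Bj ν.M₁ Z k) (avgFamily (avOfRecord F 2 Kt) U₀) Wd →
      (∀ i' : Fin (constrCard (Bj ν.M₁ Z k) k), ∃ U' : GaugeField (F.P Kt) 0 SU2,
        (∀ b ∈ feeds (((constrEnum (Bj ν.M₁ Z k) k).symm i').1 : ℕ) ((constrEnum (Bj ν.M₁ Z k) k).symm i').2.1, U' b = U₀ b) ∧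
          SmallBelow (avOfRecord F 2 Kt) k U') →
      (∀ (j : ℕ), 1 ≤ j → j ≤ k → ∀ y : Site (F.P Kt) j, embIter j y ∈ maxDomT ν.M₁ Z j → ∃ U' : GaugeField (F.P Kt) 0 SU2,
        (∀ c : PBond (F.P Kt) j, (c.src = y ∨ c.tgt = y) → ∀ b₀ : PBond (F.P Kt) 0,
          (iterBlockOf j b₀.src = c.src ∨ iterBlockOf j b₀.src = c.tgt) → (iterBlockOf j b₀.tgt = c.src ∨ iterBlockOf j b₀.tgt = c.tgt) → U' b₀ = U₀ b₀) ∧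
        SmallBelow (avOfRecord F 2 Kt) k U') →
      (∀ (j : ℕ), 1 ≤ j → j ≤ k → ∀ y : Site (F.P Kt) j, embIter j y ∈ maxDomT ν.M₁ Z j →
        PlaqSmallOn (boxPlaqs (fun κ => lift (F.P Kt) (embIter j y) κ - ((((F.P Kt).L ^ j : ℕ) : ℤ) + ((((F.P Kt).L ^ j - 1) / 2 : ℕ) : ℤ)))
          (fun κ => lift (F.P Kt) (embIter j y) κ + ((((F.P Kt).L ^ j : ℕ) : ℤ) + ((((F.P Kt).L ^ j - 1) / 2 : ℕ) : ℤ))) : Set (Plaq (F.P Kt) 0)) εH U₀) →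
      ∃ H : (Fin (constrCard (Bj ν.M₁ Z k) k) → lieSU (Fin 2)) → PBond (F.P Kt) 0 → lieSU (Fin 2),
        (∀ v, fderiv ℝ (msChart F 2 Kt k (Bj ν.M₁ Z k) Wd U₀) 0 (H v) = v) ∧ ∀ v, Real.sqrt (∑ b, ‖H v b‖ ^ 2) ≤ B * ‖v‖)
    (hεH : ν.εreg ≤ εH) :
    ∃ path : Site (F.P Kt) 0 → List (LStep (F.P Kt) 0),
      (∀ x, ∀ s ∈ path x, ∃ x' x'' : Site (F.P Kt) 0, path x'' = path x' ++ [s] ∧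
        (s.fwd = true → s.bond.src = x' ∧ s.bond.tgt = x'') ∧ (s.fwd = false → s.bond.src = x'' ∧ s.bond.tgt = x')) ∧
      (∀ j, j ≤ k → ∀ c ∈ lamBondsSeq (maxDomT ν.M₁ Z) k j, path (embIter j c.src) = [] ∧ path (embIter j c.tgt) = []) ∧
      (∀ x : Site (F.P Kt) 0, x ∉ {z : Site (F.P Kt) 0 | ∃ j, j ≤ k ∧ ∃ c ∈ lamBondsSeq (maxDomT ν.M₁ Z) k j, (z = embIter j c.src ∨ z = embIter j c.tgt)} →
        ∃ (x' : Site (F.P Kt) 0) (s : LStep (F.P Kt) 0), path x = path x' ++ [s] ∧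
          (s.fwd = true → s.bond.src = x' ∧ s.bond.tgt = x) ∧ (s.fwd = false → s.bond.src = x ∧ s.bond.tgt = x')) ∧
      ∀ {𝔅' : BDetSet (F.P Kt)} {W' : MSField (F.P Kt) SU2} {U₀ : GaugeField (F.P Kt) 0 SU2},
        IsMinimizerB (avOfRecord F 2 Kt) (regMSCoPOfRecord F 2 ν Kt k (maxDomT ν.M₁ Z)) 𝔅' W' U₀ →
        ∀ {W : MSField (F.P Kt) SU2}, AgreeOnB (lamBondsSeq (maxDomT ν.M₁ Z) k) (avgFamily (avOfRecord F 2 Kt) U₀) W →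
          ∃ H : (Fin (constrCardB (lamBondsSeq (maxDomT ν.M₁ Z) k) k) → lieSU (Fin 2)) →ₗ[ℝ] (PBond (F.P Kt) 0 → lieSU (Fin 2)),
            (∀ τ, ∀ x, ∀ s ∈ path x, H τ s.bond = 0) ∧ ∀ τ, fderiv ℝ (msChartB F 2 Kt k (lamBondsSeq (maxDomT ν.M₁ Z) k) W U₀) 0 (H τ) = τ := by
  have hL := three_le_L (F.P Kt)
  have hM1 : 1 ≤ ν.M₁ := by omega
  obtain ⟨path, hF1, hF2, htree⟩ := exists_rootedForest_lamBondsSeq_maxDomT (P := F.P Kt) (M₁ := ν.M₁) (Z := Z) (Nat.le_of_succ_le hkK) hk1 hM1 hdiv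
  have hroot : ∀ r ∈ {z : Site (F.P Kt) 0 | ∃ j, j ≤ k ∧ ∃ c ∈ lamBondsSeq (maxDomT ν.M₁ Z) k j, (z = embIter j c.src ∨ z = embIter j c.tgt)}, path r = [] := by
    rintro r ⟨j, hj, c, hc, rfl | rfl⟩
    · exact (hF2 j hj c hc).1
    · exact (hF2 j hj c hc).2
  exact ⟨path, hF1, hF2, htree, fun hmin _ hW =>
    exists_forest_rightInverse_lamBondsSeq_of_isMinimizerB_class ν Kt Z hkK hM4 hdiv hε hsbU hερ hHB hεH hmin hW hroot hF1⟩

end OfClass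

end Summit.QuantumFields.YangMills.BalabanUVNodes.N12ForestSliceOfProxiesB
end
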